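import Mathlib
import HarnessLib
import Summits.ABC.ABC.Theses.CongruentialReceptacle
import Summits.ABC.ABC.Theorems.CongruentialReceptacleCompactBalanceTransferSelfImprovement
import Summits.ABC.ABC.Theorems.CongruentialReceptacleCompactBalanceTransferPowerDeep
import Summits.ABC.ABC.Cruxes.CompactBalanceTransfer.Ladder

/-!
# Skeleton — G4 ladder rung `NextRungFreySzpiro` under the crux `CompactBalanceTransfer` (stmt-ABC-1725)

Line `NextRungFreySzpiro` (planner, unit `fwd-harvest-ABC-50`, 2026-08-17; rung harvest of the banked ladder of seat
`fwd-ladder-ABC-50`, now `Cruxes/CompactBalanceTransfer/Ladder.lean` + `LADDER.md`). Route `CongruentialReceptacle`,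
crux `CompactBalanceTransfer := H → ABC` (`H` = abc on every compactly balanced cell `min(a,b) ≥ κc`).

THE CONTENT of this skeleton is the RUNG (`NextRungFreySzpiro_of`, real proof), not the crux:

* rung (by name, from the ladder): `Ladder.NextRungFreySzpiro := ∃ θ < 3/2, RungBTheta (1/3) θ`, i.e. Frey–Szpiro strength
  `P_{1/3}` (`↔ F :=` Szpiro `6+ε` for the Frey curves of ALL abc-triples in elementary currency `(abc)² ≤ C·rad(abc)^(6+ε)`,
  landed `SelfImprovement.freySzpiroAll_iff_polyBalanced`, p139684) gives abc with SOME exponent `θ < 3/2`;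
* floor (PROVED, the F3 witness): `Ladder.rungBTheta_third_threeHalves : RungBTheta (1/3) (3/2)` — Oesterlé's `3/2`
  (`PowerDeep.abc_threeHalves_of_freySzpiro`; general law `Ladder.rungBTheta_floor : B < 1 → RungBTheta B (1/(1−B))`);
* on-path: `Ladder.nextRungFreySzpiro_of_crux : CompactBalanceTransfer → NextRungFreySzpiro`, converse
  `Ladder.nextRungFreySzpiro_of_abc : ABC → NextRungFreySzpiro` (the rung is a consequence of `S`, pinned below to a proved floor);
* the rung is the exponent-graded FIRST RUNG of line `birth`'s load-bearing stub `stub_freySzpiroPowerDeep` (`F → abc(1+ε)` on every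
  power-deep cell, `≡ F → ABC`, Oesterlé's 1988 gap): weaker conclusion (`θ < 3/2`, not `1+ε`), same hypothesis `F`, no `H`.

## The line (regime split of the RUNG by power-depth `η = log min(a,b) / log c`)

`F` alone gives `c < K·a^(−1/2)·rad^(3/2+ε)` (`(abc)² ≥ a²·c⁴/4`): the exponent `3/2` is attained with ZERO slack exactly on
the deepest triples (`a = 1`: there `F|_{a=1}` IS `abc_{3/2}|_{a=1}` verbatim, LADDER.md §3), and improves to `3/(2+η)` as soon as
`min(a,b) ≥ c^η`. Hence the rung splits EXACTLY into

* `stub_moderateRegime` (M, PROVABLE NOW): `F ⟹` for every `η > 0`, abc with exponent `3/(2+η) + ε` on `{η·log c ≤ log min(a,b)}` —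
  `(abc)² ≥ c^(4+2η)/4` there, so `F` at `4ε` gives `c^(4+2η) ≤ 4C·rad^(6+4ε)`; interpolates Oesterlé (`η → 0`,
  `PowerDeep.abc_threeHalves_of_freySzpiro`) and birth's landed complement lemma (`η → 1`, `PowerDeep.abc_of_freySzpiro_of_powerDeep`),
  whose 90-line log/rpow bookkeeping it adapts;
* `stub_deepRegime` (L, the OPEN content, the weakest typing): `∃ η > 0, ∃ θ < 3/2`, `F ⟹` abc with exponent `θ + ε` on the power-deep
  cell `{log min(a,b) ≤ η·log c}` — beat `3/2` on the deepest cell only (consecutive-type triples `(a, c−a, c)`, `a ≤ c^η`); every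
  companion identity tried returns `3/2` (LADDER.md §3; method floor `Negative/CorrespondenceToll.lean`), so a mechanism importing
  information from OTHER triples with gain is what is missing — implied by `ABC` (`stubSigs_of_abc` below), not refutable short of `¬ABC`;

and `NextRungFreySzpiro_of : deep → moderate → NextRungFreySzpiro` is a real proof (`θ := max θ₀ (3/(2+η))`, case split on the cell).
The power-deep cell is NOT dissolved by `Negative/DepthCellDissolution` (linear cells `min ≤ δc` only: power maps preserve `η`).

## Ladder to the crux: the LIMIT STEP (flagged; registered only so that `CompactBalanceTransfer_of` concludes the crux BY NAME,
G4 brief (3) / KZ `Lines/LogPeriodCell.lean` convention — NOT a work target of this line)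

`stub_limitStep : NextRungFreySzpiro → CompactBalanceTransfer` is crux-strength GIVEN the rung: it contains the rest of the `θ`-ladder
(`∀ θ > 1, RungBTheta (1/3) θ`, `= RungB (1/3)` = child 2 `F → ABC` by `Ladder.rungB_of_forall_theta` / `rungB_third_iff_child2`) AND
child 1 `H → P` (= birth's `stub_balancedToFreySzpiro`), glued by the landed `compactBalanceTransfer_of_subs` (p125050). Provers wanting
that part work line `birth`; the ladder is CAPPED there (lift = modified Szpiro = abc; LADDER.md §3, disposition frontier).
(`LimitStep` is a `def` so that the audited theorem concluding the crux by name is `CompactBalanceTransfer_of`, KZ convention.)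

`sorry` occurs ONLY inside the three `stub_*`; `NextRungFreySzpiro_of`, `CompactBalanceTransfer_of`, `stubSigs_of_abc` are real proofs.
-/

-- `Summit.<Summit>.<Problem>`: for the single-conjunct summit `ABC` the duplicate `ABC.ABC` is mandated.
set_option linter.dupNamespace false

namespace Summit.ABC.ABC.Cruxes.CompactBalanceTransfer.NextRungFreySzpiroLine

open Literature.NumberTheory.DiophantineGeometry
open Summit.ABC.ABC.Theses.CongruentialReceptacle
open Summit.ABC.ABC.Theorems.CompactBalanceTransfer
open Summit.ABC.ABC.Cruxes.CompactBalanceTransfer.Ladder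

/-! ## Stub statements (named; `F` is spelled inline exactly as in `Lines/birth.lean` / `Theorems/…PowerDeep.lean`) -/

/-- Statement of `stub_deepRegime`: for SOME power-depth `0 < η < 1` and SOME exponent `θ < 3/2`, Frey–Szpiro strength gives abc with
exponent `θ + ε` on the power-deep cell `log min(a,b) ≤ η·log c`. [folklore] -/
def DeepRegime : Prop :=
  ∃ η : ℝ, 0 < η ∧ η < 1 ∧ ∃ θ : ℝ, θ < 3 / 2 ∧
    ((∀ ε : ℝ, 0 < ε → ∃ C : ℝ, ∀ a b c : ℕ, IsABCTriple a b c →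
        ((a * b * c : ℕ) : ℝ) ^ 2 ≤ C * ((rad a b c : ℕ) : ℝ) ^ (6 + ε)) →
      ∀ ε : ℝ, 0 < ε → ∃ C : ℝ, ∀ a b c : ℕ, IsABCTriple a b c →
        Real.log ((min a b : ℕ) : ℝ) ≤ η * Real.log (c : ℝ) →
          (c : ℝ) < C * ((rad a b c : ℕ) : ℝ) ^ (θ + ε))

/-- Statement of `stub_moderateRegime`: for EVERY power-depth `0 < η < 1`, Frey–Szpiro strength gives abc with exponent
`3/(2+η) + ε` off the power-deep cell, i.e. on `η·log c ≤ log min(a,b)` (for `η ≥ 1` that cell is empty). [folklore] -/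
def ModerateRegime : Prop :=
  (∀ ε : ℝ, 0 < ε → ∃ C : ℝ, ∀ a b c : ℕ, IsABCTriple a b c →
      ((a * b * c : ℕ) : ℝ) ^ 2 ≤ C * ((rad a b c : ℕ) : ℝ) ^ (6 + ε)) →
    ∀ η : ℝ, 0 < η → η < 1 → ∀ ε : ℝ, 0 < ε → ∃ C : ℝ, ∀ a b c : ℕ, IsABCTriple a b c →
      η * Real.log (c : ℝ) ≤ Real.log ((min a b : ℕ) : ℝ) →
        (c : ℝ) < C * ((rad a b c : ℕ) : ℝ) ^ (3 / (2 + η) + ε)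

/-! ## Registered stubs (signatures spelled out in full, self-contained over `IsABCTriple` / `rad` / `Real.log` / `Real.rpow`,
so that `propose --supports stmt-ABC-1725` proofs can restate them without importing this module) -/

/-- **Stub 1 (L, hardest — the open content of the rung): beat Oesterlé's `3/2` on the deepest cell.**
`∃ η ∈ (0,1), ∃ θ < 3/2`: Szpiro `6+ε` for the Frey curves of all abc-triples (elementary currency) implies abc with exponent `θ + ε` on
`{log min(a,b) ≤ η·log c}`. Why plausibly true: implied by `ABC` (`stubSigs_of_abc`; take `η = 1/2, θ = 1`). Why hard: on `a = 1`
the hypothesis at the triple itself is exactly `c² ≲ rad(c(c−1))³`, zero slack; the squaring / degree-`n` companions and the rational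
2-isogeny class return `3/2` resp. leave the Frey family (`6/5` needs Szpiro for a non-Frey curve) — LADDER.md §3,
`Negative/CorrespondenceToll.lean` (method floor), census r1 T12; `F` itself improves to `c < K·a^(−1/2)·rad^(3/2+ε)`, so the residual
hard core is `a < rad(abc)^σ` for every `σ > 0`. Size: L / frontier (no mechanism on record).
Sources: Oesterle1988 §3; SilvermanAEC2009 Prop. VIII.11.5(a) p. 223 and Ex. 8.20 p. 230; arXiv:2312.03566 Thm 1.4(1). -/
theorem stub_deepRegime :
    ∃ η : ℝ, 0 < η ∧ η < 1 ∧ ∃ θ : ℝ, θ < 3 / 2 ∧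
      ((∀ ε : ℝ, 0 < ε → ∃ C : ℝ, ∀ a b c : ℕ, IsABCTriple a b c →
          ((a * b * c : ℕ) : ℝ) ^ 2 ≤ C * ((rad a b c : ℕ) : ℝ) ^ (6 + ε)) →
        ∀ ε : ℝ, 0 < ε → ∃ C : ℝ, ∀ a b c : ℕ, IsABCTriple a b c →
          Real.log ((min a b : ℕ) : ℝ) ≤ η * Real.log (c : ℝ) →
            (c : ℝ) < C * ((rad a b c : ℕ) : ℝ) ^ (θ + ε)) := by
  sorry

/-- **Stub 2 (M, provable now — first prover target): `F` off the power-deep cell gives exponent `3/(2+η)`.**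
For every `η ∈ (0,1)` and `ε > 0` there is `C` with `c < C·rad(abc)^(3/(2+η)+ε)` for all abc-triples with `η·log c ≤ log min(a,b)`.
Plan (adapt `PowerDeep.abc_threeHalves_of_freySzpiro` / `abc_of_freySzpiro_of_powerDeep`, ≈ 70 lines): the larger member is `≥ c/2`
(`PowerDeep.le_two_mul_ab_of_isABCTriple`: `c ≤ 2ab`) and the smaller is `≥ c^η`, so `log(abc) ≥ (2+η)·log c − log 2`; `F` at `4ε` in
logarithms reads `2·log(abc) ≤ log C' + (6+4ε)·log rad`; hence `(4+2η)·log c ≤ log C' + 2 log 2 + (6+4ε)·log rad`, divide by `4+2η ≥ 4`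
(`(6+4ε)/(4+2η) ≤ 3/(2+η) + ε`) and exponentiate. Sources: Oesterle1988 §3 (the `η = 0` endpoint); folklore. -/
theorem stub_moderateRegime :
    (∀ ε : ℝ, 0 < ε → ∃ C : ℝ, ∀ a b c : ℕ, IsABCTriple a b c →
        ((a * b * c : ℕ) : ℝ) ^ 2 ≤ C * ((rad a b c : ℕ) : ℝ) ^ (6 + ε)) →
      ∀ η : ℝ, 0 < η → η < 1 → ∀ ε : ℝ, 0 < ε → ∃ C : ℝ, ∀ a b c : ℕ, IsABCTriple a b c →
        η * Real.log (c : ℝ) ≤ Real.log ((min a b : ℕ) : ℝ) →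
          (c : ℝ) < C * ((rad a b c : ℕ) : ℝ) ^ (3 / (2 + η) + ε) := by
  sorry

/-- The registered signature of `stub_deepRegime` IS `DeepRegime` (textual copy; kernel: `Iff.rfl`). [folklore] -/
theorem stub_deepRegime_iff : DeepRegime ↔
    ∃ η : ℝ, 0 < η ∧ η < 1 ∧ ∃ θ : ℝ, θ < 3 / 2 ∧
      ((∀ ε : ℝ, 0 < ε → ∃ C : ℝ, ∀ a b c : ℕ, IsABCTriple a b c →
          ((a * b * c : ℕ) : ℝ) ^ 2 ≤ C * ((rad a b c : ℕ) : ℝ) ^ (6 + ε)) →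
        ∀ ε : ℝ, 0 < ε → ∃ C : ℝ, ∀ a b c : ℕ, IsABCTriple a b c →
          Real.log ((min a b : ℕ) : ℝ) ≤ η * Real.log (c : ℝ) →
            (c : ℝ) < C * ((rad a b c : ℕ) : ℝ) ^ (θ + ε)) := Iff.rfl

/-- The registered signature of `stub_moderateRegime` IS `ModerateRegime` (textual copy; kernel: `Iff.rfl`). [folklore] -/
theorem stub_moderateRegime_iff : ModerateRegime ↔
    ((∀ ε : ℝ, 0 < ε → ∃ C : ℝ, ∀ a b c : ℕ, IsABCTriple a b c →
        ((a * b * c : ℕ) : ℝ) ^ 2 ≤ C * ((rad a b c : ℕ) : ℝ) ^ (6 + ε)) →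
      ∀ η : ℝ, 0 < η → η < 1 → ∀ ε : ℝ, 0 < ε → ∃ C : ℝ, ∀ a b c : ℕ, IsABCTriple a b c →
        η * Real.log (c : ℝ) ≤ Real.log ((min a b : ℕ) : ℝ) →
          (c : ℝ) < C * ((rad a b c : ℕ) : ℝ) ^ (3 / (2 + η) + ε)) := Iff.rfl

/-! ## The composition: the two stubs prove the RUNG by name (real proof) -/

/-- **`DeepRegime → ModerateRegime → NextRungFreySzpiro`.** With `(η, θ₀)` from stub 1 put `θ := max θ₀ (3/(2+η)) < 3/2`; given
`P_{1/3}`, get `F` from the landed `SelfImprovement.freySzpiroAll_iff_polyBalanced`; for each `ε` take the larger of the two constants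
(and `0`) and split a triple according to `log min(a,b) ≤ η·log c` or not; raise exponents with `rad ≥ 1`. [folklore] -/
theorem NextRungFreySzpiro_of : DeepRegime → ModerateRegime → NextRungFreySzpiro := by
  intro h1 h2
  obtain ⟨η, hη, hη1, θ₀, hθ₀, hdeep⟩ := h1
  have h32 : (3 : ℝ) / (2 + η) < 3 / 2 := by
    rw [div_lt_iff₀ (by positivity : (0 : ℝ) < 2 + η)]
    linarith
  refine ⟨max θ₀ (3 / (2 + η)), max_lt hθ₀ h32, ?_⟩
  intro hP ε hε
  -- `P_{1/3} → F` (landed exactness of the currency split, p139684)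
  unfold PolyBalancedABC at hP
  have hF := SelfImprovement.freySzpiroAll_iff_polyBalanced.mpr hP
  obtain ⟨C₁, hC₁⟩ := hdeep hF ε hε
  obtain ⟨C₂, hC₂⟩ := h2 hF η hη hη1 ε hε
  set C : ℝ := max (max C₁ C₂) 0 with hCdef
  have hC0 : (0 : ℝ) ≤ C := le_max_right _ _
  have hC1 : C₁ ≤ C := le_trans (le_max_left _ _) (le_max_left _ _)
  have hC2 : C₂ ≤ C := le_trans (le_max_right _ _) (le_max_left _ _)
  refine ⟨C, fun a b c habc => ?_⟩
  have hR1 : (1 : ℝ) ≤ ((rad a b c : ℕ) : ℝ) := by exact_mod_cast PowerDeep.rad_pos_nat a b c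
  have hR0 : (0 : ℝ) ≤ ((rad a b c : ℕ) : ℝ) := le_trans zero_le_one hR1
  rcases le_or_gt (Real.log ((min a b : ℕ) : ℝ)) (η * Real.log (c : ℝ)) with hd | hm
  · -- deep cell: stub 1 at exponent θ₀ ≤ θ
    have h1 := hC₁ a b c habc hd
    calc (c : ℝ) < C₁ * ((rad a b c : ℕ) : ℝ) ^ (θ₀ + ε) := h1
      _ ≤ C * ((rad a b c : ℕ) : ℝ) ^ (θ₀ + ε) :=
          mul_le_mul_of_nonneg_right hC1 (Real.rpow_nonneg hR0 _)
      _ ≤ C * ((rad a b c : ℕ) : ℝ) ^ (max θ₀ (3 / (2 + η)) + ε) :=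
          mul_le_mul_of_nonneg_left
            (Real.rpow_le_rpow_of_exponent_le hR1 (by linarith [le_max_left θ₀ (3 / (2 + η))])) hC0
  · -- off the cell: stub 2 at exponent 3/(2+η) ≤ θ
    have h2' := hC₂ a b c habc hm.le
    calc (c : ℝ) < C₂ * ((rad a b c : ℕ) : ℝ) ^ (3 / (2 + η) + ε) := h2'
      _ ≤ C * ((rad a b c : ℕ) : ℝ) ^ (3 / (2 + η) + ε) :=
          mul_le_mul_of_nonneg_right hC2 (Real.rpow_nonneg hR0 _)
      _ ≤ C * ((rad a b c : ℕ) : ℝ) ^ (max θ₀ (3 / (2 + η)) + ε) :=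
          mul_le_mul_of_nonneg_left
            (Real.rpow_le_rpow_of_exponent_le hR1 (by linarith [le_max_right θ₀ (3 / (2 + η))])) hC0

/-- The rung itself, from its two stubs (closed form). [folklore] -/
theorem nextRungFreySzpiro_of_stubs : NextRungFreySzpiro :=
  NextRungFreySzpiro_of stub_deepRegime stub_moderateRegime

/-! ## Irrefutability of the stub set (sorry-free): both rung stubs follow from `ABC` -/

/-- **Both rung stubs are consequences of `ABC`** (so no `Disproof.lean` target can kill either short of `¬ABC`; cf.
`Disproof.lean` §1 `not_crux_iff`). Deep: `η = 1/2`, `θ = 1`; moderate: exponent `1 + ε ≤ 3/(2+η) + ε` as `η < 1`. [folklore] -/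
theorem stubSigs_of_abc (h : _root_.ABC) : DeepRegime ∧ ModerateRegime := by
  constructor
  · refine ⟨1 / 2, by norm_num, by norm_num, 1, by norm_num, fun _ ε hε => ?_⟩
    obtain ⟨C, _, hC⟩ := (_root_.ABC_iff.mp h) ε hε
    exact ⟨C, fun a b c habc _ => hC a b c habc⟩
  · intro _ η hη hη1 ε hε
    obtain ⟨C, hC0, hC⟩ := (_root_.ABC_iff.mp h) ε hε
    refine ⟨C, fun a b c habc _ => lt_of_lt_of_le (hC a b c habc) ?_⟩
    have hR1 : (1 : ℝ) ≤ ((rad a b c : ℕ) : ℝ) := by exact_mod_cast PowerDeep.rad_pos_nat a b c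
    have h1 : (1 : ℝ) ≤ 3 / (2 + η) := by
      rw [le_div_iff₀ (by positivity : (0 : ℝ) < 2 + η)]
      linarith
    exact mul_le_mul_of_nonneg_left (Real.rpow_le_rpow_of_exponent_le hR1 (by linarith)) hC0.le

/-! ## Ladder to the top: the LIMIT STEP (flagged — crux-strength given the rung; NOT a work target of this line) -/

/-- **Stub 3 (LIMIT STEP — do not staff; work line `birth` for this part).** `NextRungFreySzpiro → CompactBalanceTransfer`: all
further rungs of the `θ`-ladder at once (`∀ θ > 1, RungBTheta (1/3) θ`, i.e. child 2 `F → ABC`, `Ladder.rungB_of_forall_theta`) together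
with child 1 `H → P_{1/3}` (birth's `stub_balancedToFreySzpiro`, exact shape `SelfImprovement.balancedToFreySzpiro_iff_selfImprovement`),
glued by the landed `compactBalanceTransfer_of_subs` (p125050). On its own it gives neither the crux nor `ABC` cheaply (it needs the
rung), but it is crux-strength once the rung lands; the ladder is CAPPED here (lift = modified Szpiro `max(|c₄|³,|c₆|²) ≤ C·N^(6+ε)` = abc,
`Literature …Szpiro.lean` `abcLe_iff_modifiedSzpiro_holds`; LADDER.md §3). Registered only so that `CompactBalanceTransfer_of` concludes the
crux BY NAME; the bankable target of this line is the RUNG (stubs 1–2). [folklore] -/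
def LimitStep : Prop := NextRungFreySzpiro → Summit.ABC.ABC.Theses.CongruentialReceptacle.CompactBalanceTransfer

/-- See `LimitStep`. [folklore] -/
theorem stub_limitStep : LimitStep := by
  sorry

/-- **Ladder composition to the crux BY NAME** (registered-skeleton convention: the proof USES the three `stub_*`; `sorry` lives only
inside them): the two rung stubs give `NextRungFreySzpiro` (`NextRungFreySzpiro_of`, real proof) and the limit step carries it to the crux.
[folklore] -/
theorem CompactBalanceTransfer_of : Summit.ABC.ABC.Theses.CongruentialReceptacle.CompactBalanceTransfer :=
  (show NextRungFreySzpiro → Summit.ABC.ABC.Theses.CongruentialReceptacle.CompactBalanceTransfer from stub_limitStep)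
    (NextRungFreySzpiro_of stub_deepRegime stub_moderateRegime)

end Summit.ABC.ABC.Cruxes.CompactBalanceTransfer.NextRungFreySzpiroLine
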